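import Summits.Ventures.HSemireg.Mod4CarrierMiddleDegree
import Summits.Ventures.HSemireg.WedgeWeilMirror

/-!
# Venture HSemireg — MOD-4 line: the EDGE DEGREES `k = 0` and `k = 2n` of THEOREM R_f ON THE p4 CARRIER (`R_0 = R_{2n} = 1`)

HONEST FRAMING. Part of the Lean index of the computation cell `pub-hsemireg` (widening group W3, seat w3-mod4-1 gen 7; file of
record `HOME/widen/W3/MOD4-OFFSPLIT-w3mod4.md` §11.1′ (P1), §12).  Finite-dimensional exterior algebra over a field ONLY (th-7's
transposed wedge model `⋀(K^{4n})` and p4's carrier of Weil type `(n,n)`): no abelian variety, no sheaf, no Ext group, no semiregularity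
map; nothing here says that HC, HC_CM or HC_AV holds; no Literature fact is declared or used.  WHAT IS PROVED (proof-only): the two
edge rows that MOD4-OFFSPLIT §11.1′ (P1) left «trivial, structural» — (1) MODEL: `range(∧v ∣ Λ⁰) = K·v` (`range_wedge_zero`); the Weil
vector `vW (2n) n q a b` has coordinate `a` at the block monomial `E_{G₋}` and `b` at `E_{G₊}` (`coord_Gm_vW`, `coord_Dm_vW`; `n ≥ 1`),
hence is non-zero as soon as one Weil coordinate is (`vW_ne_zero`); so `rank(∧v ∣ Λ⁰) = 1` (`weilRank_nn_zero`) and, by th-7's duality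
`finrank_range_wedge_dual` (`v` homogeneous of degree `2n`), `rank(∧v ∣ Λ^{2n}) = 1` (`weilRank_nn_top`); (2) CARRIER: by seat g6's exact
transport `finrank_S_eq_model_nn`, **`dim S_0(Ecl q (2n) + a·w₊ + b·w₋) = dim S_{2n}(Ecl q (2n) + a·w₊ + b·w₋) = 1`** for every field,
every `n ≥ 1`, every `q`, whenever `a ≠ 0 ∨ b ≠ 0` (`finrank_S_weil_nn_zero`, `finrank_S_weil_nn_top`; one-sided shapes
`finrank_S_weil_nn_one_zero/_top`, `finrank_S_weil_nn_low_zero/_top`).  With p4's lower side degrees, seat g6's middle / upper degrees and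
seat g7's one-sided column (`Mod4CarrierOneSided.lean`), THEOREM R_f is on the carrier in EVERY degree `0 ≤ k ≤ 2n`, both-sided and one-sided.
All statements and proofs: w3-mod4-1 g7 (2026-08-24).  Namespace `Summit.Ventures.HSemireg.Mod4Carrier`.
References: [BuchweitzFlenner2008HH] Prop. 6.4.4 (why these operators); [BourbakiAlgebre1a3] Ch. III §7, §11 no. 9.
-/

open Module

namespace Summit.Ventures.HSemireg.Mod4Carrier

/-! ### 1. Model: degree `0`, non-vanishing of the Weil vector, degree `2n` by duality -/

section Model

open Summit.Ventures.HSemireg.Wedge Summit.Ventures.HSemireg.Wedge.Hankel Summit.Ventures.HSemireg.Wedge.Weil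
open Summit.Ventures.HSemireg.Wedge.WeilPurity

variable (K : Type*) [Field K] {N : ℕ}

/-- `range(θ ↦ θ ∧ v ∣ Λ⁰) = K·v`. [cite: BourbakiAlgebre1a3, Ch. III §7 no. 1] -/
lemma range_wedge_zero (v : HT K (In N)) : LinearMap.range (wedge K N 0 v) = K ∙ v := by
  rw [wedge, LinearMap.range_comp, Submodule.range_subtype, ExteriorAlgebra.exteriorPower, pow_zero, Submodule.one_eq_span,
    Submodule.map_span, Set.image_singleton, LinearMap.mulRight_apply, one_mul]

/-- hence `rank(∧v ∣ Λ⁰) = 1` for `v ≠ 0`. -/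
lemma finrank_range_wedge_zero {v : HT K (In N)} (hv : v ≠ 0) :
    Module.finrank K (LinearMap.range (wedge K N 0 v)) = 1 := by
  rw [range_wedge_zero, finrank_span_singleton hv]

variable {n : ℕ}

/-- the block `G₋ = Gm n` of the last `n` pairs is not transversal (`n ≥ 1`): it contains the pair `x_n, y_n`. -/
lemma not_Tr_Gm (hn : 1 ≤ n) : ¬ Tr (Gm (n + n) n) := by
  intro h
  have hc : xJ (n + n) ⟨n, by omega⟩ ∈ Gm (n + n) n := by rw [mem_Gm_iff, pr_xJ]
  have hc' : pt (xJ (n + n) ⟨n, by omega⟩) ∈ Gm (n + n) n := by rw [pt_mem_Gm_iff]; exact hc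
  exact (h _).mp hc hc'

/-- the block `G₊ = Dm n` of the first `n` pairs is not transversal (`n ≥ 1`): it contains the pair `x_0, y_0`. -/
lemma not_Tr_Dm (hn : 1 ≤ n) : ¬ Tr (Dm (n + n) n) := by
  intro h
  have hc : xJ (n + n) ⟨0, by omega⟩ ∈ Dm (n + n) n := by rw [mem_Dm_iff, pr_xJ]; exact hn
  have hc' : pt (xJ (n + n) ⟨0, by omega⟩) ∈ Dm (n + n) n := by
    rw [mem_Dm_iff, pr_pt, pr_xJ]; exact hn
  exact (h _).mp hc hc'

/-- `G₋ ≠ G₊` (`n ≥ 1`). -/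
lemma Gm_ne_Dm (hn : 1 ≤ n) : Gm (n + n) n ≠ Dm (n + n) n := by
  intro h
  have hc : xJ (n + n) ⟨n, by omega⟩ ∈ Gm (n + n) n := by rw [mem_Gm_iff, pr_xJ]
  rw [h, mem_Dm_iff, pr_xJ] at hc
  exact lt_irrefl n hc

/-- the coordinate of the Weil vector `f + a·w₊ + b·w₋` at the block monomial `E_{G₋}` is `a` (`n ≥ 1`). -/
lemma coord_Gm_vW (hn : 1 ≤ n) (q : ℕ → K) (a b : K) :
    (B K (In (n + n))).coord (Gm (n + n) n) (vW K (n + n) n q a b) = a := by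
  have hw : (B K (In (n + n))).coord (Gm (n + n) n) (w K (n + n) (n + n) q) = 0 :=
    coord_eq_zero_of_mem_Sp (f_mem_Sp K n q) fun h => not_Tr_Gm hn h.1
  rw [vW, map_add, map_add, map_smul, map_smul, hw, zero_add, Basis.coord_apply, Basis.coord_apply, Basis.repr_self,
    Basis.repr_self, Finsupp.single_eq_same, Finsupp.single_eq_of_ne (Gm_ne_Dm hn), smul_eq_mul, mul_one, smul_eq_mul,
    mul_zero, add_zero]

/-- the coordinate of the Weil vector `f + a·w₊ + b·w₋` at the block monomial `E_{G₊}` is `b` (`n ≥ 1`). -/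
lemma coord_Dm_vW (hn : 1 ≤ n) (q : ℕ → K) (a b : K) :
    (B K (In (n + n))).coord (Dm (n + n) n) (vW K (n + n) n q a b) = b := by
  have hw : (B K (In (n + n))).coord (Dm (n + n) n) (w K (n + n) (n + n) q) = 0 :=
    coord_eq_zero_of_mem_Sp (f_mem_Sp K n q) fun h => not_Tr_Dm hn h.1
  rw [vW, map_add, map_add, map_smul, map_smul, hw, zero_add, Basis.coord_apply, Basis.coord_apply, Basis.repr_self,
    Basis.repr_self, Finsupp.single_eq_same, Finsupp.single_eq_of_ne (Gm_ne_Dm hn).symm, smul_eq_mul, smul_eq_mul, mul_zero,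
    mul_one, zero_add]

/-- the Weil vector is non-zero as soon as one Weil coordinate is (`n ≥ 1`; the h-part may vanish). -/
lemma vW_ne_zero (hn : 1 ≤ n) (q : ℕ → K) {a b : K} (hab : a ≠ 0 ∨ b ≠ 0) : vW K (n + n) n q a b ≠ 0 := by
  intro h
  rcases hab with ha | hb
  · exact ha (by rw [← coord_Gm_vW K hn q a b, h, map_zero])
  · exact hb (by rw [← coord_Dm_vW K hn q a b, h, map_zero])

/-- **EDGE DEGREE `0` IN THE MODEL** (Weil type `(n,n)`, `n ≥ 1`, `a ≠ 0 ∨ b ≠ 0`, every `q`, every field): `rank(∧v ∣ Λ⁰) = 1`.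
[cite: BuchweitzFlenner2008HH, Prop. 6.4.4] -/
theorem weilRank_nn_zero (hn : 1 ≤ n) (q : ℕ → K) {a b : K} (hab : a ≠ 0 ∨ b ≠ 0) :
    Module.finrank K (LinearMap.range (wedge K (n + n) 0 (vW K (n + n) n q a b))) = 1 :=
  finrank_range_wedge_zero K (vW_ne_zero K hn q hab)

/-- **EDGE DEGREE `2n` IN THE MODEL** (Weil type `(n,n)`, `n ≥ 1`, `a ≠ 0 ∨ b ≠ 0`): `rank(∧v ∣ Λ^{2n}) = 1` (th-7's duality
`finrank_range_wedge_dual`, `v` homogeneous of degree `2n`). [cite: BuchweitzFlenner2008HH, Prop. 6.4.4] -/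
theorem weilRank_nn_top (hn : 1 ≤ n) (q : ℕ → K) {a b : K} (hab : a ≠ 0 ∨ b ≠ 0) :
    Module.finrank K (LinearMap.range (wedge K (n + n) (n + n) (vW K (n + n) n q a b))) = 1 := by
  rw [finrank_range_wedge_dual K (n := n + n) (d := n + n) (m := n + n) (m' := 0) (by omega) (vW_nn_mem_Hom K n q a b)]
  exact weilRank_nn_zero K hn q hab

end Model

/-! ### 2. Carrier: `dim S_0 = dim S_{2n} = 1` for the two-sided and the one-sided classes -/

section Carrier

open Summit.Ventures.HSemireg.WedgeBridge Summit.Ventures.HSemireg.WeilCarrier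
open Summit.Ventures.HSemireg.Wedge.Hankel Summit.Ventures.HSemireg.Wedge.Weil

variable {K : Type*} [Field K] {n : ℕ} {V : Type*} [AddCommGroup V] [Module K V] (bV : Basis (Fin ((n + n) + (n + n))) K V)

omit [AddCommGroup V] [Module K V] in
/-- the transported Weil coordinates `((−1)^{n·n}·a, b)` have a non-zero entry iff `(a, b)` has. -/
lemma sign_mul_ne_zero_or {a b : K} (hab : a ≠ 0 ∨ b ≠ 0) : (-1 : K) ^ (n * n) * a ≠ 0 ∨ b ≠ 0 :=
  hab.imp (fun ha => mul_ne_zero (pow_ne_zero _ (neg_ne_zero.mpr one_ne_zero)) ha) id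

/-- **EDGE DEGREE `0` ON THE CARRIER** (Weil type `(n,n)`, `n ≥ 1`, every `q`, `a ≠ 0 ∨ b ≠ 0`, every field):
`dim S_0(Ecl q (2n) + a·w₊ + b·w₋) = 1` (`R_0 = 1`). [cite: BuchweitzFlenner2008HH, Prop. 6.4.4] -/
theorem finrank_S_weil_nn_zero (hn : 1 ≤ n) (q : ℕ → K) {a b : K} (hab : a ≠ 0 ∨ b ≠ 0) :
    Module.finrank K (S K (Lsp bV) 0 (Ecl bV q (n + n) + a • wUp bV n + b • wLow bV n)) = 1 := by
  rw [finrank_S_eq_model_nn]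
  exact weilRank_nn_zero K hn q (sign_mul_ne_zero_or hab)

/-- **EDGE DEGREE `2n` ON THE CARRIER** (Weil type `(n,n)`, `n ≥ 1`, every `q`, `a ≠ 0 ∨ b ≠ 0`, every field):
`dim S_{2n}(Ecl q (2n) + a·w₊ + b·w₋) = 1` (`R_{2n} = 1`). [cite: BuchweitzFlenner2008HH, Prop. 6.4.4] -/
theorem finrank_S_weil_nn_top (hn : 1 ≤ n) (q : ℕ → K) {a b : K} (hab : a ≠ 0 ∨ b ≠ 0) :
    Module.finrank K (S K (Lsp bV) (n + n) (Ecl bV q (n + n) + a • wUp bV n + b • wLow bV n)) = 1 := by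
  rw [finrank_S_eq_model_nn]
  exact weilRank_nn_top K hn q (sign_mul_ne_zero_or hab)

/-- one-sided, `a`-side: `dim S_0(Ecl q (2n) + a·w₊) = 1` (`n ≥ 1`, `a ≠ 0`). -/
theorem finrank_S_weil_nn_one_zero (hn : 1 ≤ n) (q : ℕ → K) {a : K} (ha : a ≠ 0) :
    Module.finrank K (S K (Lsp bV) 0 (Ecl bV q (n + n) + a • wUp bV n)) = 1 := by
  have h := finrank_S_weil_nn_zero bV hn q (b := 0) (Or.inl ha)
  rwa [zero_smul, add_zero] at h

/-- one-sided, `a`-side: `dim S_{2n}(Ecl q (2n) + a·w₊) = 1` (`n ≥ 1`, `a ≠ 0`). -/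
theorem finrank_S_weil_nn_one_top (hn : 1 ≤ n) (q : ℕ → K) {a : K} (ha : a ≠ 0) :
    Module.finrank K (S K (Lsp bV) (n + n) (Ecl bV q (n + n) + a • wUp bV n)) = 1 := by
  have h := finrank_S_weil_nn_top bV hn q (b := 0) (Or.inl ha)
  rwa [zero_smul, add_zero] at h

/-- one-sided, `b`-side: `dim S_0(Ecl q (2n) + b·w₋) = 1` (`n ≥ 1`, `b ≠ 0`). -/
theorem finrank_S_weil_nn_low_zero (hn : 1 ≤ n) (q : ℕ → K) {b : K} (hb : b ≠ 0) :
    Module.finrank K (S K (Lsp bV) 0 (Ecl bV q (n + n) + b • wLow bV n)) = 1 := by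
  have h := finrank_S_weil_nn_zero bV hn q (a := 0) (Or.inr hb)
  rwa [zero_smul, add_zero] at h

/-- one-sided, `b`-side: `dim S_{2n}(Ecl q (2n) + b·w₋) = 1` (`n ≥ 1`, `b ≠ 0`). -/
theorem finrank_S_weil_nn_low_top (hn : 1 ≤ n) (q : ℕ → K) {b : K} (hb : b ≠ 0) :
    Module.finrank K (S K (Lsp bV) (n + n) (Ecl bV q (n + n) + b • wLow bV n)) = 1 := by
  have h := finrank_S_weil_nn_top bV hn q (a := 0) (Or.inr hb)
  rwa [zero_smul, add_zero] at h

end Carrier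

end Summit.Ventures.HSemireg.Mod4Carrier
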